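import Literature.AnabelianGeometry.EtaleTheta.RootsOfUnityGalois
import Mathlib.RingTheory.Polynomial.Eisenstein.IsIntegral
import Mathlib.RingTheory.Polynomial.GaussLemma
import Mathlib.RingTheory.Polynomial.Cyclotomic.Roots
import Mathlib.RingTheory.Polynomial.Cyclotomic.Eval
import Mathlib.NumberTheory.Padics.PadicIntegers
import Mathlib.FieldTheory.Galois.Infinite
import HarnessLib

/-!
# The `p`-adic cyclotomic character of `G_{ℚ_p}` is non-trivial: `ζ_{p²} ∉ ℚ_p` (classical)

Classical complement (proof-only, Mathlib-level) to `RootsOfUnityGalois.lean` (`MuN p N = μ_N(ℚ̄_p)` with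
its Galois action `galMuN p N : G_{ℚ_p} → Aut(μ_N)`, [cite: MochizukiEtTh2009, Def 2.10 p.44]). [EtTh] §1
p. 12 writes "`Δ_Θ (≅ Ẑ(1))`" — a TATE TWIST: `G_K` acts on `Δ_Θ` through the cyclotomic character. For the
cell's non-vacuity programme (abc-iut-L2-lead, NV-L2 rows; R78 «χ-twisted root model») one needs the
kernel fact that this character is NOT trivial on `G_{ℚ_p}`, i.e. that `G_{ℚ_p}` moves some root of unity
of `ℚ̄_p`. We prove the uniform-in-`p` instance (also covering `p = 2`, where it reads "`i ∉ ℚ₂`"):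

* `cyclotomic_sq_comp_X_add_one_isEisensteinAt_padicInt` — `Φ_{p²}(X+1) ∈ ℤ_p[X]` is Eisenstein at the
  maximal ideal (transport of Mathlib's `cyclotomic_prime_pow_comp_X_add_one_isEisensteinAt` from `ℤ`);
* `irreducible_cyclotomic_sq_comp_padic` — `Φ_{p²}(X+1)` is irreducible over `ℚ_p` (Eisenstein + Gauss);
* `not_isRoot_cyclotomic_sq_padic` — `Φ_{p²}` has no root in `ℚ_p` (its degree is `p(p-1) ≥ 2`);
* `not_mem_range_algebraMap_of_isPrimitiveRoot_sq` — a primitive `p²`-th root of unity of `ℚ̄_p` is not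
  in `ℚ_p`; `exists_isPrimitiveRoot_sq_and_forall_ne` — such a root exists;
* `exists_algEquiv_apply_ne_of_isPrimitiveRoot_sq` — some `σ ∈ G_{ℚ_p}` moves it (infinite Galois
  correspondence: `ℚ_p` is the fixed field of `G_{ℚ_p}`);
* **`exists_galMuN_apply_ne`** — for every `N` with `p² ∣ N`, some `σ ∈ G_{ℚ_p}` acts non-trivially on
  `μ_N(ℚ̄_p)`: the mod-`N` cyclotomic character `galMuN p N` is non-trivial (`galMuN_ne_one`).

[cite: SerreLocalFields1979, IV §4 Prop 17] (`ℚ_p(ζ_{pⁿ})/ℚ_p` totally ramified of degree `φ(pⁿ)`). No definition, no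
Prop fact; nothing of [EtTh] is asserted; no side is taken on [IUTchIII] Cor. 3.12.
-/

noncomputable section

namespace Literature.AnabelianGeometry.EtaleTheta

open Polynomial Literature.AnabelianGeometry.SemiGraphs

variable (p : ℕ) [hp : Fact p.Prime]

/-! ### Eisenstein over `ℤ_p` and irreducibility over `ℚ_p` -/

omit hp in
/-- `Φ_{p²}(X + 1) ∈ ℤ[X]` is monic. [folklore] -/
private theorem monic_cyclotomic_sq_comp_X_add_one : ((cyclotomic (p ^ 2) ℤ).comp (X + 1)).Monic := by
  rw [show (X + 1 : ℤ[X]) = X + C 1 by simp]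
  refine (cyclotomic.monic _ ℤ).comp (monic_X_add_C 1) fun h => ?_
  rw [natDegree_X_add_C] at h
  exact zero_ne_one h.symm

/-- The degree of `Φ_{p²}(X + 1)` is `φ(p²) = p(p-1)`. [folklore] -/
private theorem natDegree_cyclotomic_sq_comp_X_add_one :
    ((cyclotomic (p ^ 2) ℤ).comp (X + 1)).natDegree = p * (p - 1) := by
  rw [natDegree_comp, show (X + 1 : ℤ[X]) = X + C 1 by simp, natDegree_X_add_C, mul_one,
    natDegree_cyclotomic, Nat.totient_prime_pow hp.out two_pos]
  simp

/-- `2 ≤ p(p-1)` for a prime `p`. [folklore] -/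
private theorem two_le_mul_pred_of_prime : 2 ≤ p * (p - 1) := by
  have h2 : 2 ≤ p := hp.out.two_le
  have h1 : 1 ≤ p - 1 := by omega
  calc 2 = 2 * 1 := by norm_num
    _ ≤ p * (p - 1) := Nat.mul_le_mul h2 h1

/-- **`Φ_{p²}(X+1)` is Eisenstein at the maximal ideal of `ℤ_p`** (coefficients below the leading one are
divisible by `p` — Mathlib's `cyclotomic_prime_pow_comp_X_add_one_isEisensteinAt` over `ℤ`, transported —
and the constant coefficient `Φ_{p²}(1) = p` is not in `(p)² = (p²)`) — the Eisenstein step of Serre's proof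
that `ℚ_p(ζ_{pⁿ})/ℚ_p` is totally ramified of degree `φ(pⁿ)`. [cite: SerreLocalFields1979, IV §4 Prop 17] -/
theorem cyclotomic_sq_comp_X_add_one_isEisensteinAt_padicInt :
    (((cyclotomic (p ^ 2) ℤ).comp (X + 1)).map (Int.castRingHom ℤ_[p])).IsEisensteinAt
      (IsLocalRing.maximalIdeal ℤ_[p]) := by
  have hE : ((cyclotomic (p ^ 2) ℤ).comp (X + 1)).IsEisensteinAt (Submodule.span ℤ {(p : ℤ)}) :=
    cyclotomic_prime_pow_comp_X_add_one_isEisensteinAt p 1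
  have hmonic := (monic_cyclotomic_sq_comp_X_add_one p).map (Int.castRingHom ℤ_[p])
  refine hmonic.isEisensteinAt_of_mem_of_notMem (IsLocalRing.maximalIdeal.isMaximal ℤ_[p]).ne_top ?_ ?_
  · intro n hn
    have hw := (hE.isWeaklyEisensteinAt.map (Int.castRingHom ℤ_[p])).mem hn
    have hmap : Ideal.map (Int.castRingHom ℤ_[p]) (Submodule.span ℤ {(p : ℤ)}) =
        Ideal.span {(p : ℤ_[p])} := by
      rw [Ideal.submodule_span_eq, Ideal.map_span, Set.image_singleton, map_natCast]
    rw [PadicInt.maximalIdeal_eq_span_p, ← hmap]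
    exact hw
  · rw [coeff_map, coeff_zero_eq_eval_zero, eval_comp, eval_add, eval_X, eval_one, zero_add,
      eval_one_cyclotomic_prime_pow, map_natCast, PadicInt.maximalIdeal_eq_span_p,
      Ideal.span_singleton_pow, Ideal.mem_span_singleton]
    rintro ⟨c, hc⟩
    have hp0 : (p : ℤ_[p]) ≠ 0 := by exact_mod_cast hp.out.ne_zero
    have h1 : (p : ℤ_[p]) * 1 = (p : ℤ_[p]) * (p * c) := by rw [mul_one, ← mul_assoc, ← sq]; exact hc
    have h2 : (1 : ℤ_[p]) = p * c := mul_left_cancel₀ hp0 h1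
    exact (PadicInt.irreducible_p (p := p)).not_isUnit (isUnit_iff_exists_inv.2 ⟨c, h2.symm⟩)

/-- `Φ_{p²}(X+1)` is irreducible over `ℤ_p` (Eisenstein criterion). [cite: SerreLocalFields1979, IV §4 Prop 17] -/
theorem irreducible_cyclotomic_sq_comp_padicInt :
    Irreducible (((cyclotomic (p ^ 2) ℤ).comp (X + 1)).map (Int.castRingHom ℤ_[p])) := by
  have hmonic := (monic_cyclotomic_sq_comp_X_add_one p).map (Int.castRingHom ℤ_[p])
  refine (cyclotomic_sq_comp_X_add_one_isEisensteinAt_padicInt p).irreducible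
    (IsLocalRing.maximalIdeal.isMaximal ℤ_[p]).isPrime hmonic.isPrimitive ?_
  rw [(monic_cyclotomic_sq_comp_X_add_one p).natDegree_map, natDegree_cyclotomic_sq_comp_X_add_one]
  exact lt_of_lt_of_le two_pos (two_le_mul_pred_of_prime p)

/-- The base change to `ℚ_p` of `Φ_{p²}(X+1) ∈ ℤ_p[X]` is `Φ_{p²}(X+1) ∈ ℚ_p[X]`. [folklore] -/
private theorem map_cyclotomic_sq_comp_eq :
    (((cyclotomic (p ^ 2) ℤ).comp (X + 1)).map (Int.castRingHom ℤ_[p])).map (algebraMap ℤ_[p] ℚ_[p]) =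
      (cyclotomic (p ^ 2) ℚ_[p]).comp (X + 1) := by
  rw [Polynomial.map_map, map_comp, Polynomial.map_add, map_X, Polynomial.map_one]
  congr 1
  have : (algebraMap ℤ_[p] ℚ_[p]).comp (Int.castRingHom ℤ_[p]) = Int.castRingHom ℚ_[p] :=
    RingHom.ext_int _ _
  rw [this, map_cyclotomic_int]

/-- **`Φ_{p²}(X+1)` is irreducible over `ℚ_p`** (Gauss's lemma over the integrally closed `ℤ_p`) —
equivalently `[ℚ_p(ζ_{p²}) : ℚ_p] = φ(p²)`. [cite: SerreLocalFields1979, IV §4 Prop 17] -/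
theorem irreducible_cyclotomic_sq_comp_padic : Irreducible ((cyclotomic (p ^ 2) ℚ_[p]).comp (X + 1)) := by
  rw [← map_cyclotomic_sq_comp_eq]
  exact (((monic_cyclotomic_sq_comp_X_add_one p).map
    (Int.castRingHom ℤ_[p])).irreducible_iff_irreducible_map_fraction_map (K := ℚ_[p])).1
    (irreducible_cyclotomic_sq_comp_padicInt p)

/-- **`Φ_{p²}` has no root in `ℚ_p`**: a root `x` would make `x - 1` a root of the irreducible
`Φ_{p²}(X+1)` of degree `p(p-1) ≥ 2`. [cite: SerreLocalFields1979, IV §4 Prop 17] -/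
theorem not_isRoot_cyclotomic_sq_padic (x : ℚ_[p]) : ¬ IsRoot (cyclotomic (p ^ 2) ℚ_[p]) x := by
  intro hx
  have hroot : IsRoot ((cyclotomic (p ^ 2) ℚ_[p]).comp (X + 1)) (x - 1) := by
    rw [IsRoot, eval_comp, eval_add, eval_X, eval_one, sub_add_cancel]
    exact hx
  have h1 := degree_eq_one_of_irreducible_of_root (irreducible_cyclotomic_sq_comp_padic p) hroot
  have hdeg : ((cyclotomic (p ^ 2) ℚ_[p]).comp (X + 1)).natDegree = p * (p - 1) := by
    rw [natDegree_comp, show (X + 1 : ℚ_[p][X]) = X + C 1 by simp, natDegree_X_add_C, mul_one,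
      natDegree_cyclotomic, Nat.totient_prime_pow hp.out two_pos]
    simp
  have h2 : ((cyclotomic (p ^ 2) ℚ_[p]).comp (X + 1)).natDegree = 1 := natDegree_eq_of_degree_eq_some h1
  have := two_le_mul_pred_of_prime p
  omega

/-! ### A primitive `p²`-th root of unity of `ℚ̄_p` is moved by `G_{ℚ_p}` -/

/-- A primitive `p²`-th root of unity of `ℚ̄_p` does not lie in `ℚ_p` (`ℚ_p(ζ_{p²}) ≠ ℚ_p`).
[cite: SerreLocalFields1979, IV §4 Prop 17] -/
theorem not_mem_range_algebraMap_of_isPrimitiveRoot_sq {ζ : PadicAlgCl p} (hζ : IsPrimitiveRoot ζ (p ^ 2)) :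
    ζ ∉ Set.range (algebraMap ℚ_[p] (PadicAlgCl p)) := by
  rintro ⟨x, rfl⟩
  have hx : IsPrimitiveRoot x (p ^ 2) :=
    hζ.of_map_of_injective (f := algebraMap ℚ_[p] (PadicAlgCl p)) (algebraMap ℚ_[p] (PadicAlgCl p)).injective
  haveI : NeZero ((p ^ 2 : ℕ) : ℚ_[p]) := ⟨by exact_mod_cast pow_ne_zero 2 hp.out.ne_zero⟩
  exact not_isRoot_cyclotomic_sq_padic p x ((isRoot_cyclotomic_iff).2 hx)

/-- `ℚ̄_p` contains a primitive `p²`-th root of unity (characteristic `0`, algebraically closed).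
[folklore] -/
private theorem exists_isPrimitiveRoot_sq : ∃ ζ : PadicAlgCl p, IsPrimitiveRoot ζ (p ^ 2) := by
  haveI : NeZero ((p : ℕ) : PadicAlgCl p) := ⟨by exact_mod_cast hp.out.ne_zero⟩
  exact HasEnoughRootsOfUnity.prim

/-- **Some `σ ∈ G_{ℚ_p}` moves a primitive `p²`-th root of unity** (`ℚ_p` is the fixed field of
`G_{ℚ_p} = Gal(ℚ̄_p/ℚ_p)`, infinite Galois correspondence): `Gal(ℚ_p(ζ_{p²})/ℚ_p) ≅ (ℤ/p²)^× ≠ 1`.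
[cite: SerreLocalFields1979, IV §4 Prop 17] -/
theorem exists_algEquiv_apply_ne_of_isPrimitiveRoot_sq {ζ : PadicAlgCl p}
    (hζ : IsPrimitiveRoot ζ (p ^ 2)) : ∃ σ : GQp p, σ ζ ≠ ζ := by
  by_contra hall
  haveI : IsGalois ℚ_[p] (PadicAlgCl p) := {}
  have hmem : ζ ∈ IntermediateField.fixedField (⊤ : Subgroup (GQp p)) := by
    rw [IntermediateField.mem_fixedField_iff]
    intro σ _
    by_contra hne
    exact hall ⟨σ, hne⟩
  rw [← IntermediateField.fixingSubgroup_bot, InfiniteGalois.fixedField_fixingSubgroup,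
    IntermediateField.mem_bot] at hmem
  exact not_mem_range_algebraMap_of_isPrimitiveRoot_sq p hζ hmem

/-- Packaged: there are `ζ ∈ ℚ̄_p` primitive of order `p²` and `σ ∈ G_{ℚ_p}` with `σ ζ ≠ ζ`.
[cite: SerreLocalFields1979, IV §4 Prop 17] -/
theorem exists_isPrimitiveRoot_sq_and_apply_ne :
    ∃ (ζ : PadicAlgCl p) (σ : GQp p), IsPrimitiveRoot ζ (p ^ 2) ∧ σ ζ ≠ ζ := by
  obtain ⟨ζ, hζ⟩ := exists_isPrimitiveRoot_sq p
  obtain ⟨σ, hσ⟩ := exists_algEquiv_apply_ne_of_isPrimitiveRoot_sq p hζ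
  exact ⟨ζ, σ, hζ, hσ⟩

/-! ### The mod-`N` cyclotomic character of `G_{ℚ_p}` is non-trivial for `p² ∣ N` -/

/-- **For `p² ∣ N`, some `σ ∈ G_{ℚ_p}` acts non-trivially on `μ_N(ℚ̄_p)`**: `G_{ℚ_p}` does NOT fix the
`N`-th roots of unity pointwise — the content of "`Ẑ(1)`" as opposed to `Ẑ` ([EtTh] §1 p. 12
"`Δ_Θ (≅ Ẑ(1))`"). [cite: MochizukiEtTh2009, Def 2.10 p.44] -/
theorem exists_galMuN_apply_ne (N : ℕ+) (hN : p ^ 2 ∣ (N : ℕ)) :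
    ∃ (σ : GQp p) (ζ : MuN p N), galMuN p N σ ζ ≠ ζ := by
  obtain ⟨ζ, σ, hζ, hσ⟩ := exists_isPrimitiveRoot_sq_and_apply_ne p
  have hunit : IsUnit ζ := hζ.isUnit (pow_ne_zero 2 hp.out.ne_zero)
  have hmem : hunit.unit ∈ rootsOfUnity N (PadicAlgCl p) := by
    rw [mem_rootsOfUnity, Units.ext_iff, Units.val_pow_eq_pow_val, IsUnit.unit_spec, Units.val_one]
    obtain ⟨k, hk⟩ := hN
    rw [hk, pow_mul, hζ.pow_eq_one, one_pow]
  refine ⟨σ, ⟨hunit.unit, hmem⟩, fun h => hσ ?_⟩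
  have h' := congrArg (fun u : MuN p N => ((u : (PadicAlgCl p)ˣ) : PadicAlgCl p)) h
  simpa only [galMuN_apply_coe, IsUnit.unit_spec] using h'

/-- Equivalently: the mod-`N` cyclotomic character `galMuN p N : G_{ℚ_p} → Aut(μ_N)` is not the trivial
homomorphism when `p² ∣ N`. [cite: MochizukiEtTh2009, Def 2.10 p.44] -/
theorem galMuN_ne_one (N : ℕ+) (hN : p ^ 2 ∣ (N : ℕ)) : galMuN p N ≠ 1 := by
  intro h
  obtain ⟨σ, ζ, hne⟩ := exists_galMuN_apply_ne p N hN
  exact hne (by rw [h]; rfl)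

end Literature.AnabelianGeometry.EtaleTheta

end

-- enqueue re-land 2026-08-26T07:1xZ (abc-iut-w5-d125 g3): comment-only, STRANDED-ACCEPT remedy for p427394 (no olean dispatched after the #15k reload window); no declaration changed.
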